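import Summits.AtomisticToContinuum.Crystallization.Theorems.ChartedZeroExcessLayeredLatticeLiouvilleZA

/-!
(SPLIT FOR THE 400-LINE CAP by the landing lane, hand-2 g36: this file = part 1 of 2; sequels `…ChartedZeroExcessLayeredLatticeLiouvilleZB` import it in a chain; same namespace, all FQNs unchanged.)
# Part ZB «VariantLabel» (lens-2 g76): the ORDER cut of 75E's piece (EN) — ONE crystal variant LABELS the loose ball; the junction PROVED

Docket `stmt-AtomisticToContinuum-26636` (N = `…Theses.ChartedPlanarOrder.ChartedZeroExcessLayered`), cell decomp-a2c RESIDUAL MODE, lens-2 «structural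
dichotomy (special vs generic)», generation 76.  Imports part ZA (g75, record 75E «MetricEnclosure»: (CM)(2/5) ⟸ (EN) `EnclosureNetP` ∧ (OC)
`CoreOccupancyP`, junction and enclosure trilateration PROVED there).  TARGET OF THIS GENERATION (critic row 1344): the piece **(EN)**, whose
why-might-fail (a) «coherent labelling / the `ϑp`-tame twin lamella inside the loose ball» is the SAME adversary as (OC)'s — «a shared hidden ORDER
lemma sits under both pieces; make it a typed piece so that (EN) ⟸ (SV) ∧ (EN | single variant) with the second conjunct kinematic-ATTACKABLE».  0 sorry.

## The lens, applied to WHO CERTIFIES A LOOSE ATOM'S SITE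
Record 75E pins a loose atom `x` to a site `c` by distance DATA against REGISTERED matter.  Two things are mixed in (EN) as typed in ZA: WHICH site
`c`, `cᵢ`, `c′` each atom of a chain is read against (an ORDER question: the sites must be the atom's «own» sites in ONE crystal — a twin lamella is read
consistently by its stars but against the wrong sites), and WHETHER the data exist (a KINEMATIC / combinatorial question: hop membership, near-collinear
rows in every stacking word, anchors within reach).  This part separates them by ONE new object, a **variant label** `lab : S → C`
(`IsVariantLabel ϑ τ ε r rm ℓ S K C lab`, ZB-1): a map from the atoms near `K` to the sites of the shell crystal `C` that is COHERENT ON STARS —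
`|dist x p − dist (lab x) (lab p)| ≤ ϑ + τ` for a centre pair of a tame star, `≤ 2ϑ + τ` for two members of one star — and agrees with REG-out on the
cool zone (`dist p (lab p) ≤ ε`).  It is METRIC and ROTATION-FREE (exactly what ONE consistent choice of star models delivers: PROVED bridge
`coherence_of_labelFitsStars`), and it carries NO LOCALISATION of a loose atom (`dist x (lab x)` is not bounded: that is the junction's output, via
75E's enclosure lemma) — so it is ORDER, not estimate.  With the label in hand the dichotomy of the lens is by CLASS OF ATOM:
* SPECIAL (rigid) class — **anchors** `IsAnchorAtom r rsh ℓ S K p`: members of `ϑc`-cool stars (within `4` of an atom of `moatIn S K r (r + rsh)`,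
  themselves within `ℓ − 9` of `K` so that the whole registering star lies in the REG zone).  ONE cool star with its REG-out co-members pins such a
  `p` to ITS LABEL within `ε₁` (one-star rigid extrapolation, no chain): piece **(AR)**.
* GENERIC (soft) class — the other loose atoms: they are served by LABELLED CHAINS `IsLabChain η ζ rm S K lab x x₃` (atoms of the tame zone whose
  labels are near-collinear ordered, total slop `η` against the labels) ending on an anchor, or by a rigid datum against an anchor plus a wide chain:
  piece **(LN)**, the AVAILABILITY statement «(EN) given the variant».
* The ORDER statement that ONE label serves both classes is piece **(SV)** `SingleVariantP` — the «single-variant loose ball» of row 1344, typed.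

## The node: (EN)(ε₁, ζ, κ, κ₂, Dm) ⟸ (SV)(τ) ∧ (AR)(τ, ε₁) ∧ (LN)(τ, ζ, κ, κ₂, Dm)   (junction `enclosureNetP_of_variantLabel`, PROVED; `3τ ≤ ε₁`)
* **(SV)** `SingleVariantP` (ORDER): under the binders of (QE) verbatim, for every cool shadow crystal `C` of the shell, a variant label EXISTS.
  UNDECIDED→TRUE-leaning · ATTACKABLE-M (discrete continuation of star models inward from the registered collar, layer by layer — within a close-packed
  layer there is no letter ambiguity, and the letter of each layer is pinned on the collar annulus of that layer; rigidity of `13`-atom close-packed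
  clusters at `sup`-slop `2ϑp = 1/5` against the pattern gap between distinct Barlow environments — vertex move `1/√3 ≈ 0.577` at fixed hexagon, `≳ 0.35`
  after the best rigid motion, to be certified) · INSTRUMENTABLE «Variant-T».
  Why it might fail: a lamella of different stacking CONFINED to the ball would admit no label into `C`; it is excluded only because its bounding
  Shockley partial (`|b| = 1/√3 ≈ 0.58` in nearest-neighbour units) must lie inside the ball, where every atom is two-shell CLEAN to `1/16` (the
  `IsDoorSetP` binder) and every star `ϑp`-tame — a graded core forces an environment misfit `≥ 0.16 > 1/16` somewhere (margin ≈ 2.5×) — an ORDER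
  (topological) argument, not an estimate; the graded-slip family (drift `≤ ϑp/4` per unit, `≤ 0.3` at the centre) keeps labels coherent
  (PROVED-necessary direction absent: (CM) ⇏ (SV) formally — (CM)'s `2d = 4/5` slop does not give `ϑp + τ`).
* **(AR)** `AnchorRegistrationP` (SPECIAL class, KINEMATIC): every anchor is within `ε₁` of ITS label.  TRUE-leaning at the column's `∃ϑm`
  (`ε₁ = 10⁻³ ≥ (ϑc + ε)(1 + lever ≈ 3)` needs `ϑc ≲ 2·10⁻⁴`; false as pinned for `ϑc ≥ 10⁻³`) · ATTACKABLE-S/M (Procrustes in `sup`-norm on one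
  star with `≥ 4` non-coplanar registered co-members; label identification by coherence-trilateration against the co-members, residual `≈ 0.35 < σ/2`)
  · INSTRUMENTABLE «Anchor-T».
* **(LN)** `LabelledNetP` (GENERIC class, AVAILABILITY — «(EN) given single variant»): for EVERY variant label, every inner-core atom and every unit `u`
  carry (A) an anchor whose label lies in the `κ`-cone of `u` from `lab x`, reached by a labelled chain of slop `3(ϑp + τ)` and defect `ζ`, OR (B) an
  anchor with label in the `κ`-cone of `−u` at label-distance `≥ Dm`, pair-coherent with `x` (`2ϑp + τ`), AND a wide-cone (`κ₂`) labelled chain.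
  UNDECIDED→TRUE-leaning (g75 probe3: `334/334` rows, `150/150` axes, 7 words incl. a twin word) · ATTACKABLE-M (three finite ingredients: STAR COVERING
  — labels of `S ∩ B̄(x, 4)` cover `C ∩ B̄(lab x, 3.8)` by clean two-shell induction inside the star, which settles hop membership (75E (b)); BARLOW ROW
  GEOMETRY — near-collinear `≤ 3`-hop site paths (centre hops `≤ 3.8`, or a centre hop + a pair hop `≤ 6.6`) into every `κ = 4/5`-cone in every stacking
  word, a configuration-FREE finite check per local word with a direction-covering argument; ANCHOR REACH — coarse localisation of chain atoms by the
  iterated behind-bound `(ϑp + τ)κ⁻¹ Σ κ⁻ʲ ≈ 0.48` places chain ends inside the anchor band) · INSTRUMENTABLE «Row-T» (= Enclosure-T's availability half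
  on labelled census cores).  Why it might fail: direction covering between the `150` probed axes (cone slack `κ = 0.8` vs row density), and the
  anchor band of a THIN container `K` (anchors are cool-star members, not a metric neighbourhood of `K`).
* JUNCTION (PROVED, bookkeeping only): `c := lab x`; chain sites := labels of the chain atoms (in `C` by the zone clause, `rm < ℓ`); registration of the
  chain end / rigid partner := (AR); slops `3(ϑp + τ) ≤ 3ϑp + ε₁`, `2ϑp + τ ≤ 2ϑp + ε₁` iff `3τ ≤ ε₁` (instance `τ = 1/3000`, which also covers the
  `H`-vs-`C` distance mismatch `2ϑr = 2·10⁻⁴` of the shadow clause).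
* THE SHARED LEMMA MADE EXPLICIT (PROVED, row 1344's remark): (OC) ⟸ (SV) ∧ (AR) ∧ (LN) ∧ **(CV)** `LabelCoveringP` («every site of `C` within `rI` of
  `K` is SOME atom's label» — COUNTING, conditional on the label, no order risk left: in a twin-lamella configuration no variant label exists and (CV) is
  idle) via the label-localisation lemma `dist_lab_le_of_variantLabel` (75E's enclosure lemma applied at `c = lab x`) — `coreOccupancyP_of_variantLabel`.
  Hence (CM)(2/5) ⟸ (SV) ∧ (AR) ∧ (LN) ∧ (CV) and the docket slot (QE) ⟸ (SC) ∧ (SV) ∧ (AR) ∧ (LN) ∧ (CV) ∧ (X1) ∧ (X2ᴸ♮) (PROVED instances): the ONE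
  order leaf of the loose ball is (SV); (AR) rigid, (LN) availability, (CV) counting are class-pure.
Sources: parts UC (`IsTameStar`), YZ/YZA ((SC), `placedCrystal`), ZA ((EN)/(OC), `dist_le_of_enclosed`, `IsNetChain`); Hirth–Lothe, Theory of
Dislocations, ch. 10–11 (partials bound stacking-fault discs; `|b_Shockley| = a/√6`); Conway–Sloane SPLAG ch. 7 (Barlow packings, shell patterns);
F. John 1961 / FJM 2002 §4 (one-star rigidity is `sup`-controlled, chains are not); CRITIC-LEDGER rows 1322, 1344. [this file, g76]
-/

noncomputable section
open scoped BigOperators Classical InnerProductSpace RealInnerProductSpace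
open MeasureTheory Set Metric Filter Topology
open Summit.AtomisticToContinuum.Crystallization.Theorems.ChartedPlanarOrderRigidityDoor (E3 IsClean)
open Summit.AtomisticToContinuum.Crystallization.Theorems.ChartedPlanarOrderDensityDichotomy (μS IsSep)
open Summit.AtomisticToContinuum.Crystallization.Theorems.ChartedPlanarOrderCleanScaleP (IsCleanP IsDoorSetP isCleanP_one_iff isCleanP_mono)
open Summit.AtomisticToContinuum.Crystallization.Theorems.ChartedPlanarOrderMesoCut (LayeredHom EnvClose)
open Summit.AtomisticToContinuum.Crystallization.Theorems.ChartedPlanarOrderDoorLayeredOsc (IsTwoShellAffineGood)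
open Literature.MathematicalPhysics.StatisticalMechanics (lennardJones)

namespace Summit.AtomisticToContinuum.Crystallization.Theorems.ChartedZeroExcessLayeredLatticeLiouville

/-! ### ZB-1  Variant labels, anchors, labelled chains (typed) and their PROVED kinematics -/

section Labels

/-- ★ **`IsVariantLabel ϑ τ ε r rm ℓ S K C lab` — ONE CRYSTAL VARIANT LABELS THE ATOMS NEAR `K`** (the ORDER object of this part).  `lab : E3 → E3`
sends (i) every atom of the REG zone (`dist(·, k) < ℓ` for some `k ∈ K`) to a site of `C`; it is COHERENT ON TAME STARS: (ii) for a centre `x` of the tame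
zone `coreOf S K rm` and a member `p` (`dist p x ≤ 4`) the label distance matches the atomic distance up to `ϑ + τ`; (iii) for two members `x, p` of the
star of `a ∈ coreOf S K rm`, up to `2ϑ + τ`; and (iv) on the COOL zone (`r < dist(·, K)`, inside `ℓ`) it EXTENDS the collar registration: `dist p (lab p)
≤ ε`.  Metric and rotation-free; NO bound on `dist x (lab x)` for a loose atom (no localisation, no injectivity asked — injectivity on stars is PROVED,
`IsVariantLabel.ne_of_star`).  `τ` absorbs the `H`-vs-`C` distance mismatch (`2ϑr`) and is tied to (EN)'s budget by `3τ ≤ ε₁`. [this file, g76] -/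
def IsVariantLabel (ϑ τ ε r rm ℓ : ℝ) (S K C : Set E3) (lab : E3 → E3) : Prop :=
  (∀ p ∈ S, (∃ k ∈ K, dist p k < ℓ) → lab p ∈ C) ∧
    (∀ x ∈ coreOf S K rm, ∀ p ∈ S, dist p x ≤ 4 → |dist x p - dist (lab x) (lab p)| ≤ ϑ + τ) ∧
      (∀ a ∈ coreOf S K rm, ∀ x ∈ S, ∀ p ∈ S, dist x a ≤ 4 → dist p a ≤ 4 → |dist x p - dist (lab x) (lab p)| ≤ 2 * ϑ + τ) ∧
        ∀ p ∈ S, (∃ k ∈ K, dist p k < ℓ) → (∀ k ∈ K, r < dist p k) → dist p (lab p) ≤ ε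

/-- a variant label is one for larger slops / tolerance (WEAKER). [this file, g76] -/
theorem IsVariantLabel.mono {ϑ ϑ' τ τ' ε ε' r rm ℓ : ℝ} {S K C : Set E3} {lab : E3 → E3} (hϑ : ϑ ≤ ϑ') (hτ : τ ≤ τ') (hε : ε ≤ ε')
    (h : IsVariantLabel ϑ τ ε r rm ℓ S K C lab) : IsVariantLabel ϑ' τ' ε' r rm ℓ S K C lab := by
  obtain ⟨h₁, h₂, h₃, h₄⟩ := h
  refine ⟨h₁, fun x hx p hp hpx => (h₂ x hx p hp hpx).trans (by linarith), fun a ha x hx p hp hxa hpa =>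
    (h₃ a ha x hx p hp hxa hpa).trans (by linarith), fun p hp hz hc => (h₄ p hp hz hc).trans hε⟩

/-- **VACUITY CONTROL (PROVED)**: on the perfect corner `S ⊆ C` (e.g. `S = C = H`, the F18 corner of part YX, served by `isCoolShadowCrystal_self`) the
IDENTITY is a variant label with coherence slop `0` — the predicate is inhabited, and (SV) asks nothing there. [this file, g76] -/
theorem isVariantLabel_id {ϑ τ ε r rm ℓ : ℝ} {S K C : Set E3} (hSC : S ⊆ C) (h₁ : 0 ≤ ϑ + τ) (h₂ : 0 ≤ 2 * ϑ + τ) (hε : 0 ≤ ε) :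
    IsVariantLabel ϑ τ ε r rm ℓ S K C id := by
  refine ⟨fun p hp _ => hSC hp, fun x _ p _ _ => ?_, fun a _ x _ p _ _ _ => ?_, fun p _ _ _ => ?_⟩
  · simpa using h₁
  · simpa using h₂
  · simpa using hε

/-- ★ **LABELS ARE INJECTIVE ON STARS (PROVED)**: two distinct members of one tame star carry distinct labels as soon as the hard core of `S` beats the
pair slop (`2ϑ + τ < s₀`; door sets: `s₀ = 27/32` vs `0.2004`).  No global injectivity is asked or needed. [this file, g76] -/
theorem IsVariantLabel.ne_of_star {ϑ τ ε r rm ℓ s₀ : ℝ} {S K C : Set E3} {lab : E3 → E3} {a x p : E3}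
    (h : IsVariantLabel ϑ τ ε r rm ℓ S K C lab) (hsep : IsSep s₀ S) (hslop : 2 * ϑ + τ < s₀) (ha : a ∈ coreOf S K rm) (hx : x ∈ S)
    (hp : p ∈ S) (hxa : dist x a ≤ 4) (hpa : dist p a ≤ 4) (hne : x ≠ p) : lab x ≠ lab p := by
  intro heq
  have hcoh := h.2.2.1 a ha x hx p hp hxa hpa
  rw [heq, dist_self, sub_zero, abs_of_nonneg dist_nonneg] at hcoh
  have := hsep x hx p hp hne
  linarith

/-- **`LabelFitsStars ϑ τ rm S K H lab`** — the MODEL-level form of «single variant»: every tame-zone star has a star model `(U, g)` (part ZA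
`IsStarModel`, = the body of `IsTameStar`) whose model distances agree with the LABEL distances up to `τ` on the star.  I.e. the local crystal patches the
stars are read against can be chosen as patches of ONE labelling. [this file, g76] -/
def LabelFitsStars (ϑ τ rm : ℝ) (S K H : Set E3) (lab : E3 → E3) : Prop :=
  ∀ a ∈ coreOf S K rm, ∃ (U : E3 ≃ₗᵢ[ℝ] E3) (g : E3 → E3), IsStarModel ϑ S H a U g ∧
    ∀ x ∈ S, ∀ p ∈ S, dist x a ≤ 4 → dist p a ≤ 4 → |dist (g x) (g p) - dist (lab x) (lab p)| ≤ τ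

/-- ★ **BRIDGE (PROVED): tameness + ONE fitting labelling ⇒ the coherence clauses (ii), (iii) of a variant label** — by ZA's rotation-free readings
(`netHop_of_isReadTriple_self`, `netHop_of_isReadTriple`).  So (SV) is exactly «the star models can be chosen consistently with one map into `C`»: ORDER.
[this file, g76] -/
theorem coherence_of_labelFitsStars {ϑ τ rm : ℝ} {S K H : Set E3} {lab : E3 → E3} (h : LabelFitsStars ϑ τ rm S K H lab) :
    (∀ x ∈ coreOf S K rm, ∀ p ∈ S, dist p x ≤ 4 → |dist x p - dist (lab x) (lab p)| ≤ ϑ + τ) ∧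
      ∀ a ∈ coreOf S K rm, ∀ x ∈ S, ∀ p ∈ S, dist x a ≤ 4 → dist p a ≤ 4 → |dist x p - dist (lab x) (lab p)| ≤ 2 * ϑ + τ := by
  refine ⟨fun x hx p hp hpx => ?_, fun a ha x hx p hp hxa hpa => ?_⟩
  · obtain ⟨U, g, hM, hfit⟩ := h x hx
    have hxx : dist x x ≤ 4 := by rw [dist_self]; norm_num
    exact netHop_of_isReadTriple_self ⟨U, g, hM, hx.1, hxx, hp, hpx, rfl⟩ (hfit x hx.1 p hp hxx hpx)
  · obtain ⟨U, g, hM, hfit⟩ := h a ha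
    exact netHop_of_isReadTriple ⟨U, g, hM, hx, hxa, hp, hpa, rfl⟩ (hfit x hx p hp hxa hpa)

/-- ★ **`IsAnchorAtom r rsh ℓ S K p` — THE SPECIAL CLASS: members of cool stars.**  `p` is an atom within `ℓ − 9` of `K` lying within `4` of an atom `a`
of the cool zone `moatIn S K r (r + rsh)` (whose star is `ϑc`-tame by the binders); then every member of `a`'s star lies in the REG zone
(`anchorStar_subset_regZone`), so `a`'s star is read against REGISTERED co-members.  Intrinsic (no metric neighbourhood of `K` is an anchor zone for a thin
container). [this file, g76] -/
def IsAnchorAtom (r rsh ℓ : ℝ) (S K : Set E3) (p : E3) : Prop :=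
  p ∈ coreOf S K (ℓ - 9) ∧ ∃ a ∈ moatIn S K r (r + rsh), dist p a ≤ 4

/-- an anchor is an atom of the REG zone. [this file, g76] -/
theorem IsAnchorAtom.zone {r rsh ℓ : ℝ} {S K : Set E3} {p : E3} (h : IsAnchorAtom r rsh ℓ S K p) : p ∈ S ∧ ∃ k ∈ K, dist p k < ℓ := by
  obtain ⟨⟨hpS, k, hk, hpk⟩, -⟩ := h
  exact ⟨hpS, k, hk, by linarith⟩

/-- the registering star of an anchor lies in the REG zone (the reason for the constant `ℓ − 9 = ℓ − 4 − 4 − 1`). [this file, g76] -/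
theorem anchorStar_subset_regZone {ℓ : ℝ} {S K : Set E3} {p a q : E3} (hp : p ∈ coreOf S K (ℓ - 9)) (hpa : dist p a ≤ 4)
    (hqa : dist q a ≤ 4) : ∃ k ∈ K, dist q k < ℓ := by
  obtain ⟨-, k, hk, hpk⟩ := hp
  refine ⟨k, hk, ?_⟩
  have h1 := dist_triangle q a p
  have h2 := dist_triangle q p k
  rw [dist_comm a p] at h1
  linarith

/-- ★ **`IsLabChain η ζ rm S K lab x x₃` — a LABELLED soft chain** (the generic class's datum, given the variant): atoms `x → x₁ → x₂ → x₃` with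
`x₁, x₂` in the tame zone, total slop of the atomic hops AGAINST THE LABELS `≤ η`, labels near-collinear ordered (`Σ dist ≤ dist (lab x) (lab x₃) + ζ`).
Degenerate hops allowed (a centre hop + a pair hop is `x₂ = x₃`).  How a prover achieves `η`: coherence (ii)/(iii) of the label on readable hops.
[this file, g76] -/
def IsLabChain (η ζ rm : ℝ) (S K : Set E3) (lab : E3 → E3) (x x₃ : E3) : Prop :=
  ∃ x₁ x₂ : E3, x₁ ∈ coreOf S K rm ∧ x₂ ∈ coreOf S K rm ∧
    |dist x x₁ - dist (lab x) (lab x₁)| + |dist x₁ x₂ - dist (lab x₁) (lab x₂)| + |dist x₂ x₃ - dist (lab x₂) (lab x₃)| ≤ η ∧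
      dist (lab x) (lab x₁) + dist (lab x₁) (lab x₂) + dist (lab x₂) (lab x₃) ≤ dist (lab x) (lab x₃) + ζ

/-- the labelled soft datum (PROVED): `dist x x₃ ≤ dist (lab x) (lab x₃) + (η + ζ)` — used by (LN)-provers for the coarse localisation of chain atoms.
[this file, g76] -/
theorem dist_le_of_isLabChain {η ζ rm : ℝ} {S K : Set E3} {lab : E3 → E3} {x x₃ : E3} (h : IsLabChain η ζ rm S K lab x x₃) :
    dist x x₃ ≤ dist (lab x) (lab x₃) + (η + ζ) := by
  obtain ⟨x₁, x₂, -, -, hη, hζ⟩ := h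
  have t := dist_triangle4 x x₁ x₂ x₃
  have a₁ := le_abs_self (dist x x₁ - dist (lab x) (lab x₁))
  have a₂ := le_abs_self (dist x₁ x₂ - dist (lab x₁) (lab x₂))
  have a₃ := le_abs_self (dist x₂ x₃ - dist (lab x₂) (lab x₃))
  linarith

/-- ★ **BRIDGE (PROVED): a labelled chain whose end is `ε₁`-registered to ITS label is a net chain of 75E along the LABEL sites.** [this file, g76] -/
theorem isNetChain_of_isLabChain {η η' ζ ε₁ rm ℓ : ℝ} {S K C : Set E3} {lab : E3 → E3} {x x₃ : E3} (h : IsLabChain η ζ rm S K lab x x₃)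
    (hη : η ≤ η') (hzone : ∀ p ∈ S, (∃ k ∈ K, dist p k < ℓ) → lab p ∈ C) (hrm : rm < ℓ) (hx₃ : x₃ ∈ S) (hanc : dist x₃ (lab x₃) ≤ ε₁) :
    IsNetChain η' ζ ε₁ S C x (lab x) (lab x₃) := by
  obtain ⟨x₁, x₂, ⟨hx₁S, k₁, hk₁, hx₁k⟩, ⟨hx₂S, k₂, hk₂, hx₂k⟩, hs, hd⟩ := h
  exact ⟨x₁, x₂, x₃, lab x₁, lab x₂, hx₁S, hx₂S, hx₃, hzone x₁ hx₁S ⟨k₁, hk₁, lt_of_le_of_lt hx₁k hrm⟩,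
    hzone x₂ hx₂S ⟨k₂, hk₂, lt_of_le_of_lt hx₂k hrm⟩, hs.trans hη, hd, hanc⟩

end Labels

end Summit.AtomisticToContinuum.Crystallization.Theorems.ChartedZeroExcessLayeredLatticeLiouville

end
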